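import Summits.ValiantsHypothesis.ValiantsHypothesis.Theorems.LacunarySymmetroidMatrixDescartesPivotArrowFiveBlock

/-!
# `MatrixDescartes` (stmt-ValiantsHypothesis-18050) — the `K = 5` PIVOT COLUMN AT ALL SIZES: the balanced arrowhead
# LETTERS in `Fin (k+1)` format (positive semidefiniteness, index one, the determinant at `x > 0`)

HONEST FRAMING.  Cell `pub-symmetroid`, seat `val-sym-mdr-p2` (gen 9); helper file `--supports` the crux
`Theses.LacunarySymmetroid.MatrixDescartes` (OPEN), NO closure claim.  Second half of the linear algebra of the `K = 5`
balanced arrowhead block of `…PivotArrowFiveBlock` (support `(3; 0, 2; 5, 19, 291)`, data of the `(2,5)` TEN certificate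
`…PivotTwoFiveTen`): the five letters and the pivot as `(k+1) × (k+1)` matrices, `P ⪰ 0` for each letter (Schur
complements `1, 0, 0, 0, s`), `J + W Wᵀ ⪰ 0` for ONE column `W` (index one), and
`det(x³J + P_a + x²P_b + x⁵Q_c + x¹⁹Q_d + x²⁹¹Q_e) = (∏ᵢ mᵢ(x))·x³·(M₅(x) + s x²⁸⁸)` at `x > 0`
(`M₅(x) = x⁻³ − 1 + ∑ᵢ Uᵢ φ₅(x/Ξᵢ)`).  `K = 5` clone of `…PivotArrowFourLetters` (gen 8).  Consumed by `…PivotArrowFive`.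
Nothing here bears on `MatrixDescartes` in its window, on `stub_twoSided`, `DoorA26` / `DoorA34`, the census registers,
or `VP ≠ VNP`.

[folklore] Elementary linear algebra over Mathlib; tree inputs `WLawArrow.posSemidef_arrow`, `WLawArrow.det_arrow`,
`Pivot.eval_det_pivot`, `PivotArrowFive.pencil_arrow_eq/schur_eq`.  Axioms `propext`, `Classical.choice`, `Quot.sound`.
-/

set_option linter.dupNamespace false

namespace Summit.ValiantsHypothesis.ValiantsHypothesis.Theorems.LacunarySymmetroidMatrixDescartes

open scoped BigOperators Topology Matrix
open Filter Matrix Polynomial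

namespace PivotArrowFive

/-- The reference block shape `φ₅` (local notation, no definition). -/
local notation3 (prettyPrint := false) "φ₅[" y "]" =>
  ((y : ℝ) ^ 2 * (4 * (8 / 125 + 307 / 100 * (y : ℝ) ^ 2) * (9385 + 1591 * (y : ℝ) ^ 14 + 15411 / 10 ^ 30 * (y : ℝ) ^ 286)
      - 321233929 / 10000 * (y : ℝ))
    / (8 / 125 + 307 / 100 * (y : ℝ) ^ 2 + 17923 / 100 * (y : ℝ) ^ 3 + 9385 * (y : ℝ) ^ 5 + 1591 * (y : ℝ) ^ 19
      + 15411 / 10 ^ 30 * (y : ℝ) ^ 291))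

/-- The scalar model `M₅(x) = x⁻³ − 1 + ∑ᵢ Uᵢ φ₅(x / Ξᵢ)` (local notation, no definition). -/
local notation3 (prettyPrint := false) "M₅[" Ξ ", " U "](" x ")" =>
  ((x : ℝ)⁻¹ ^ 3 - 1 + ∑ i, (U : Fin _ → ℝ) i * φ₅[(x : ℝ) / (Ξ : Fin _ → ℝ) i])

/-! ## The letters in `Fin (k+1)` format, positive semidefiniteness, and the determinant at `x > 0` -/

/-- Letter `P_a` (exponent `0`; local notation, no definition). -/
local notation3 (prettyPrint := false) "Pa5[" Ξ ", " U "]" =>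
  Matrix.fromBlocks (diagonal fun i => 8 / 125 * (Ξ : Fin _ → ℝ) i ^ 579 / (U : Fin _ → ℝ) i)
    (Matrix.of fun (i : Fin _) (_ : Fin 1) => 8 / 125 * (Ξ : Fin _ → ℝ) i ^ 291)
    (Matrix.of fun (_ : Fin 1) (i : Fin _) => 8 / 125 * (Ξ : Fin _ → ℝ) i ^ 291)
    (Matrix.of fun (_ _ : Fin 1) => (∑ i, 8 / 125 * (U : Fin _ → ℝ) i * (Ξ : Fin _ → ℝ) i ^ 3) + 1)

/-- Letter `P_b` (exponent `2`; local notation, no definition). -/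
local notation3 (prettyPrint := false) "Pb5[" Ξ ", " U "]" =>
  Matrix.fromBlocks (diagonal fun i => 307 / 100 * (Ξ : Fin _ → ℝ) i ^ 577 / (U : Fin _ → ℝ) i)
    (Matrix.of fun (i : Fin _) (_ : Fin 1) => 307 / 100 * (Ξ : Fin _ → ℝ) i ^ 289)
    (Matrix.of fun (_ : Fin 1) (i : Fin _) => 307 / 100 * (Ξ : Fin _ → ℝ) i ^ 289)
    (Matrix.of fun (_ _ : Fin 1) => ∑ i, 307 / 100 * (U : Fin _ → ℝ) i * (Ξ : Fin _ → ℝ) i)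

/-- The pivot letter `J` (exponent `3`; diagonal; local notation, no definition). -/
local notation3 (prettyPrint := false) "J5[" Ξ ", " U "]" =>
  Matrix.fromBlocks (diagonal fun i => 17923 / 100 * (Ξ : Fin _ → ℝ) i ^ 576 / (U : Fin _ → ℝ) i) 0 0
    (Matrix.of fun (_ _ : Fin 1) => -1 - 17923 / 100 * ∑ i, (U : Fin _ → ℝ) i)

/-- Letter `Q_c` (exponent `5`; local notation, no definition). -/
local notation3 (prettyPrint := false) "Qc5[" Ξ ", " U "]" =>
  Matrix.fromBlocks (diagonal fun i => 9385 * (Ξ : Fin _ → ℝ) i ^ 574 / (U : Fin _ → ℝ) i)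
    (Matrix.of fun (i : Fin _) (_ : Fin 1) => -(9385 * (Ξ : Fin _ → ℝ) i ^ 286))
    (Matrix.of fun (_ : Fin 1) (i : Fin _) => -(9385 * (Ξ : Fin _ → ℝ) i ^ 286))
    (Matrix.of fun (_ _ : Fin 1) => ∑ i, 9385 * (U : Fin _ → ℝ) i / (Ξ : Fin _ → ℝ) i ^ 2)

/-- Letter `Q_d` (exponent `19`; local notation, no definition). -/
local notation3 (prettyPrint := false) "Qd5[" Ξ ", " U "]" =>
  Matrix.fromBlocks (diagonal fun i => 1591 * (Ξ : Fin _ → ℝ) i ^ 560 / (U : Fin _ → ℝ) i)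
    (Matrix.of fun (i : Fin _) (_ : Fin 1) => -(1591 * (Ξ : Fin _ → ℝ) i ^ 272))
    (Matrix.of fun (_ : Fin 1) (i : Fin _) => -(1591 * (Ξ : Fin _ → ℝ) i ^ 272))
    (Matrix.of fun (_ _ : Fin 1) => ∑ i, 1591 * (U : Fin _ → ℝ) i / (Ξ : Fin _ → ℝ) i ^ 16)

/-- Letter `Q_e` (exponent `291`; carries the slack `s`; local notation, no definition). -/
local notation3 (prettyPrint := false) "Qe5[" Ξ ", " U ", " s "]" =>
  Matrix.fromBlocks (diagonal fun i => 15411 / 10 ^ 30 * (Ξ : Fin _ → ℝ) i ^ 288 / (U : Fin _ → ℝ) i)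
    (Matrix.of fun (_ : Fin _) (_ : Fin 1) => -(15411 / 10 ^ 30 : ℝ))
    (Matrix.of fun (_ : Fin 1) (_ : Fin _) => -(15411 / 10 ^ 30 : ℝ))
    (Matrix.of fun (_ _ : Fin 1) => (∑ i, 15411 / 10 ^ 30 * (U : Fin _ → ℝ) i / (Ξ : Fin _ → ℝ) i ^ 288) + (s : ℝ))

/-- Reindexing `Fin k ⊕ Fin 1 ≃ Fin (k + 1)` (local notation). -/
local notation3 (prettyPrint := false) "rx[" A "]" => Matrix.reindex finSumFinEquiv finSumFinEquiv A

/-- The five PSD letters as a `Fin 5`-family (local notation). -/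
local notation3 (prettyPrint := false) "P5[" Ξ ", " U ", " s "]" =>
  (![rx[Pa5[Ξ, U]], rx[Pb5[Ξ, U]], rx[Qc5[Ξ, U]], rx[Qd5[Ξ, U]], rx[Qe5[Ξ, U, s]]] :
    Fin 5 → Matrix (Fin (_ + 1)) (Fin (_ + 1)) ℝ)

/-- The pencil of reindexed letters is the reindexed pencil. [bookkeeping] -/
theorem reindex_pencil {k : ℕ} (J A B C D E : Matrix (Fin k ⊕ Fin 1) (Fin k ⊕ Fin 1) ℝ) (x : ℝ) :
    x ^ 3 • rx[J] + (x ^ 0 • rx[A] + x ^ 2 • rx[B] + x ^ 5 • rx[C] + x ^ 19 • rx[D] + x ^ 291 • rx[E])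
      = rx[x ^ 3 • J + (x ^ 0 • A + x ^ 2 • B + x ^ 5 • C + x ^ 19 • D + x ^ 291 • E)] := by
  ext i j
  simp [Matrix.reindex_apply]

/-- `J` is symmetric. [bookkeeping] -/
theorem isSymm_J {k : ℕ} (Ξ U : Fin k → ℝ) : (rx[J5[Ξ, U]]).IsSymm := by
  rw [Matrix.reindex_apply]
  refine Matrix.IsSymm.submatrix ?_ _
  refine Matrix.IsSymm.fromBlocks (isSymm_diagonal _) (by simp) ?_
  ext i j; fin_cases i; fin_cases j; rfl

/-- **The pivot letter has index one**: `J + W Wᵀ ⪰ 0` for the column `W = (0, …, 0, √(1 + j∑Uᵢ))ᵀ`. [folklore] -/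
theorem indexOne_J {k : ℕ} (Ξ U : Fin k → ℝ) (hU : ∀ i, 0 < U i) :
    ∃ W : Matrix (Fin (k + 1)) (Fin 1) ℝ, (rx[J5[Ξ, U]] + W * Wᵀ).PosSemidef := by
  set c : ℝ := 1 + 17923 / 100 * ∑ i, U i with hc
  have hc0 : 0 ≤ c := by
    rw [hc]
    have : 0 ≤ ∑ i, U i := Finset.sum_nonneg fun i _ => (hU i).le
    linarith
  set W₀ : Matrix (Fin k ⊕ Fin 1) (Fin 1) ℝ := Matrix.of (Sum.elim (fun _ _ => (0 : ℝ)) fun _ _ => Real.sqrt c)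
    with hW₀
  refine ⟨W₀.submatrix finSumFinEquiv.symm (Equiv.refl (Fin 1)), ?_⟩
  have hblock : J5[Ξ, U] + W₀ * W₀ᵀ
      = Matrix.fromBlocks (diagonal fun i => 17923 / 100 * Ξ i ^ 576 / U i) 0 0 (0 : Matrix (Fin 1) (Fin 1) ℝ) := by
    ext i j
    rcases i with i | i <;> rcases j with j | j
    · simp [hW₀, Matrix.mul_apply, Matrix.fromBlocks]
    · simp [hW₀, Matrix.mul_apply, Matrix.fromBlocks]
    · simp [hW₀, Matrix.mul_apply, Matrix.fromBlocks]
    · simp only [hW₀, Matrix.add_apply, Matrix.fromBlocks_apply₂₂, Matrix.of_apply, Matrix.mul_apply,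
        Matrix.transpose_apply, Sum.elim_inr, Finset.sum_const, Finset.card_univ, Fintype.card_fin,
        nsmul_eq_mul, Nat.cast_one, one_mul, Matrix.zero_apply]
      rw [Real.mul_self_sqrt hc0, hc]
      ring
  have hrx : rx[J5[Ξ, U]] + W₀.submatrix finSumFinEquiv.symm (Equiv.refl (Fin 1))
        * (W₀.submatrix finSumFinEquiv.symm (Equiv.refl (Fin 1)))ᵀ
      = rx[J5[Ξ, U] + W₀ * W₀ᵀ] := by
    rw [Matrix.transpose_submatrix, Matrix.reindex_apply, Matrix.reindex_apply, Matrix.submatrix_add]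
    congr 1
  rw [hrx, hblock, Matrix.reindex_apply]
  refine Matrix.PosSemidef.submatrix ?_ _
  refine posSemidef_fromBlocks_zero (posSemidef_diagonal_iff.2 fun i => ?_) Matrix.PosSemidef.zero
  have := hU i
  positivity

/-- `P_a ⪰ 0` (Schur complement `1`). [folklore] -/
theorem posSemidef_Pa {k : ℕ} (Ξ U : Fin k → ℝ) (hΞ : ∀ i, 0 < Ξ i) (hU : ∀ i, 0 < U i) :
    (rx[Pa5[Ξ, U]]).PosSemidef := by
  rw [Matrix.reindex_apply]
  refine Matrix.PosSemidef.submatrix ?_ _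
  refine WLawArrow.posSemidef_arrow _ _ _ (fun i => by have := hΞ i; have := hU i; positivity) ?_
  have : ∑ i, (8 / 125 * Ξ i ^ 291) ^ 2 / (8 / 125 * Ξ i ^ 579 / U i) = ∑ i, 8 / 125 * U i * Ξ i ^ 3 := by
    refine Finset.sum_congr rfl fun i _ => ?_
    have h1 := (hΞ i).ne'
    have h2 := (hU i).ne'
    field_simp
  rw [this]
  linarith

/-- `P_b ⪰ 0` (Schur complement `0`). [folklore] -/
theorem posSemidef_Pb {k : ℕ} (Ξ U : Fin k → ℝ) (hΞ : ∀ i, 0 < Ξ i) (hU : ∀ i, 0 < U i) :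
    (rx[Pb5[Ξ, U]]).PosSemidef := by
  rw [Matrix.reindex_apply]
  refine Matrix.PosSemidef.submatrix ?_ _
  refine WLawArrow.posSemidef_arrow _ _ _ (fun i => by have := hΞ i; have := hU i; positivity) (le_of_eq ?_)
  refine Finset.sum_congr rfl fun i _ => ?_
  have h1 := (hΞ i).ne'
  have h2 := (hU i).ne'
  field_simp

/-- `Q_c ⪰ 0` (Schur complement `0`). [folklore] -/
theorem posSemidef_Qc {k : ℕ} (Ξ U : Fin k → ℝ) (hΞ : ∀ i, 0 < Ξ i) (hU : ∀ i, 0 < U i) :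
    (rx[Qc5[Ξ, U]]).PosSemidef := by
  rw [Matrix.reindex_apply]
  refine Matrix.PosSemidef.submatrix ?_ _
  refine WLawArrow.posSemidef_arrow _ _ _ (fun i => by have := hΞ i; have := hU i; positivity) (le_of_eq ?_)
  refine Finset.sum_congr rfl fun i _ => ?_
  have h1 := (hΞ i).ne'
  have h2 := (hU i).ne'
  field_simp

/-- `Q_d ⪰ 0` (Schur complement `0`). [folklore] -/
theorem posSemidef_Qd {k : ℕ} (Ξ U : Fin k → ℝ) (hΞ : ∀ i, 0 < Ξ i) (hU : ∀ i, 0 < U i) :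
    (rx[Qd5[Ξ, U]]).PosSemidef := by
  rw [Matrix.reindex_apply]
  refine Matrix.PosSemidef.submatrix ?_ _
  refine WLawArrow.posSemidef_arrow _ _ _ (fun i => by have := hΞ i; have := hU i; positivity) (le_of_eq ?_)
  refine Finset.sum_congr rfl fun i _ => ?_
  have h1 := (hΞ i).ne'
  have h2 := (hU i).ne'
  field_simp

/-- `Q_e ⪰ 0` (Schur complement `s ≥ 0`). [folklore] -/
theorem posSemidef_Qe {k : ℕ} (Ξ U : Fin k → ℝ) (hΞ : ∀ i, 0 < Ξ i) (hU : ∀ i, 0 < U i) {s : ℝ}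
    (hs : 0 ≤ s) : (rx[Qe5[Ξ, U, s]]).PosSemidef := by
  rw [Matrix.reindex_apply]
  refine Matrix.PosSemidef.submatrix ?_ _
  refine WLawArrow.posSemidef_arrow _ (fun _ => -(15411 / 10 ^ 30 : ℝ)) _
    (fun i => by have := hΞ i; have := hU i; positivity) ?_
  have : ∑ i, (-(15411 / 10 ^ 30 : ℝ)) ^ 2 / (15411 / 10 ^ 30 * Ξ i ^ 288 / U i)
      = ∑ i, 15411 / 10 ^ 30 * U i / Ξ i ^ 288 := by
    refine Finset.sum_congr rfl fun i _ => ?_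
    have h1 := (hΞ i).ne'
    have h2 := (hU i).ne'
    field_simp
  rw [this]
  linarith

/-- All five letters are positive semidefinite (as a `Fin 5`-family). [bookkeeping] -/
theorem posSemidef_letters {k : ℕ} (Ξ U : Fin k → ℝ) (hΞ : ∀ i, 0 < Ξ i) (hU : ∀ i, 0 < U i) {s : ℝ}
    (hs : 0 ≤ s) : ∀ l : Fin 5, (P5[Ξ, U, s] l).PosSemidef := by
  intro l
  fin_cases l
  · simpa using posSemidef_Pa Ξ U hΞ hU
  · simpa using posSemidef_Pb Ξ U hΞ hU
  · simpa using posSemidef_Qc Ξ U hΞ hU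
  · simpa using posSemidef_Qd Ξ U hΞ hU
  · simpa using posSemidef_Qe Ξ U hΞ hU hs

/-- **The determinant of the balanced arrowhead pivot pencil at `x > 0`** is
`(∏ᵢ mᵢ(x)) · x³ · (M₅(x) + s x²⁸⁸)` with `mᵢ(x) > 0`. [folklore] -/
theorem det_pencil_eval {k : ℕ} (Ξ U : Fin k → ℝ) (hΞ : ∀ i, 0 < Ξ i) (hU : ∀ i, 0 < U i) (s : ℝ)
    {x : ℝ} (hx : 0 < x) :
    (Matrix.det (((X : ℝ[X]) ^ 3) • (rx[J5[Ξ, U]]).map Polynomial.C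
        + ∑ l, ((X : ℝ[X]) ^ (![0, 2, 5, 19, 291] : Fin 5 → ℕ) l) • (P5[Ξ, U, s] l).map Polynomial.C)).eval x
      = (∏ i, (8 / 125 * Ξ i ^ 579 + 307 / 100 * Ξ i ^ 577 * x ^ 2 + 17923 / 100 * Ξ i ^ 576 * x ^ 3 + 9385 * Ξ i ^ 574 * x ^ 5 + 1591 * Ξ i ^ 560 * x ^ 19 + 15411 / 10 ^ 30 * Ξ i ^ 288 * x ^ 291) / U i) * (x ^ 3 * (M₅[Ξ, U](x) + s * x ^ 288)) := by
  rw [Pivot.eval_det_pivot]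
  simp only [Fin.sum_univ_five, Matrix.cons_val_zero, Matrix.cons_val_one, Matrix.cons_val_two,
    Matrix.cons_val_three, Matrix.cons_val_four, Matrix.head_cons, Matrix.tail_cons]
  rw [reindex_pencil, Matrix.det_reindex_self, pencil_arrow_eq,
    WLawArrow.det_arrow _ _ _ (fun i => (m_pos (hΞ i) (hU i) hx.le).ne'), schur_eq Ξ U hΞ hU s hx]

/-- Hence, at positive points, opposite signs of `M₅ + s x²⁸⁸` give a negative product of the determinant values.
[bookkeeping] -/
theorem eval_mul_eval_neg {k : ℕ} (Ξ U : Fin k → ℝ) (hΞ : ∀ i, 0 < Ξ i) (hU : ∀ i, 0 < U i) (s : ℝ)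
    {x y : ℝ} (hx : 0 < x) (hy : 0 < y)
    (hneg : (M₅[Ξ, U](x) + s * x ^ 288) * (M₅[Ξ, U](y) + s * y ^ 288) < 0) :
    (Matrix.det (((X : ℝ[X]) ^ 3) • (rx[J5[Ξ, U]]).map Polynomial.C
        + ∑ l, ((X : ℝ[X]) ^ (![0, 2, 5, 19, 291] : Fin 5 → ℕ) l) • (P5[Ξ, U, s] l).map Polynomial.C)).eval x
      * (Matrix.det (((X : ℝ[X]) ^ 3) • (rx[J5[Ξ, U]]).map Polynomial.C
        + ∑ l, ((X : ℝ[X]) ^ (![0, 2, 5, 19, 291] : Fin 5 → ℕ) l) • (P5[Ξ, U, s] l).map Polynomial.C)).eval y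
      < 0 := by
  rw [det_pencil_eval Ξ U hΞ hU s hx, det_pencil_eval Ξ U hΞ hU s hy]
  have hc : 0 < (∏ i, (8 / 125 * Ξ i ^ 579 + 307 / 100 * Ξ i ^ 577 * x ^ 2 + 17923 / 100 * Ξ i ^ 576 * x ^ 3 + 9385 * Ξ i ^ 574 * x ^ 5 + 1591 * Ξ i ^ 560 * x ^ 19 + 15411 / 10 ^ 30 * Ξ i ^ 288 * x ^ 291) / U i) * x ^ 3 :=
    mul_pos (Finset.prod_pos fun i _ => m_pos (hΞ i) (hU i) hx.le) (pow_pos hx 3)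
  have hd : 0 < (∏ i, (8 / 125 * Ξ i ^ 579 + 307 / 100 * Ξ i ^ 577 * y ^ 2 + 17923 / 100 * Ξ i ^ 576 * y ^ 3 + 9385 * Ξ i ^ 574 * y ^ 5 + 1591 * Ξ i ^ 560 * y ^ 19 + 15411 / 10 ^ 30 * Ξ i ^ 288 * y ^ 291) / U i) * y ^ 3 :=
    mul_pos (Finset.prod_pos fun i _ => m_pos (hΞ i) (hU i) hy.le) (pow_pos hy 3)
  set A := M₅[Ξ, U](x) + s * x ^ 288 with hA
  set B := M₅[Ξ, U](y) + s * y ^ 288 with hB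
  set c := (∏ i, (8 / 125 * Ξ i ^ 579 + 307 / 100 * Ξ i ^ 577 * x ^ 2 + 17923 / 100 * Ξ i ^ 576 * x ^ 3 + 9385 * Ξ i ^ 574 * x ^ 5 + 1591 * Ξ i ^ 560 * x ^ 19 + 15411 / 10 ^ 30 * Ξ i ^ 288 * x ^ 291) / U i) with hcdef
  set d := (∏ i, (8 / 125 * Ξ i ^ 579 + 307 / 100 * Ξ i ^ 577 * y ^ 2 + 17923 / 100 * Ξ i ^ 576 * y ^ 3 + 9385 * Ξ i ^ 574 * y ^ 5 + 1591 * Ξ i ^ 560 * y ^ 19 + 15411 / 10 ^ 30 * Ξ i ^ 288 * y ^ 291) / U i) with hddef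
  have : c * (x ^ 3 * A) * (d * (y ^ 3 * B)) = (c * x ^ 3) * (d * y ^ 3) * (A * B) := by ring
  rw [this]
  exact mul_neg_of_pos_of_neg (mul_pos hc hd) hneg

end PivotArrowFive

end Summit.ValiantsHypothesis.ValiantsHypothesis.Theorems.LacunarySymmetroidMatrixDescartes
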